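import Summits.ABC.ABC.Theorems.YuMatveevShapeRatCloses
import Summits.ABC.ABC.Theorems.PlacewiseSzpiroSingleTowerSzpiroBakerSinglePlace
import Summits.ABC.ABC.Theorems.PlacewiseSzpiroSingleTowerSzpiroFreySmallPrimes
import Summits.ABC.ABC.Theorems.PlacewiseSzpiroSingleTowerSzpiroFreyLargePrimes
import HarnessLib

/-!
# Route PlacewiseSzpiro, crux `SingleTowerSzpiro` (stmt-ABC-22410): the single-tower calibrations of the
# Baker method, UNCONDITIONALLY (the input `PastenApproximationBound K` discharged by name)

`Summits/ABC/ABC/Theorems/SingleTowerSzpiroUnconditionalCorollaries.lean` — unit `abc-inputs-pr-1` (KEY A1L-SWEEP,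
INPUTS-LIST row I-16; D-0154 (2) INPUTS→UNCONDITIONAL). PROOFS ONLY (0 definitions, 0 named facts, no `Theses`
import; the three landed files are untouched). Every theorem below is the one-line glue

  `obtain ⟨K, hK, hP⟩ := approximationBound_rat_holds; exact <K-parametric theorem> hK hP …`

where `Summit.ABC.ABC.Theorems.approximationBound_rat_holds : Dioph.approximationBound_rat`
(`= ∃ K : ℝ, 1 ≤ K ∧ PastenApproximationBound K`; `YuMatveevShapeRatCloses.lean`, route `YuMatveevShapeRat`
CLOSED·proved: Matveev 2000 archimedean core + Yu 2007 `p`-adic cores, odd and `2`, PROVED in the tree) removes the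
hypotheses `(hK : 1 ≤ K) (hP : PastenApproximationBound K)` from the `K`-parametric theorems of

* `PlacewiseSzpiroSingleTowerSzpiroBakerSinglePlace.lean` (★ p585329):
  `exists_single_place_bound_of_approximationBound` ↦ **`exists_single_place_bound`**
  (`ν_p(abc) · log p ≤ C(η) · p · rad(abc)^η` at every prime `p ∣ abc` of every abc triple),
  `exists_single_place_bound_below_stewartYu_of_approximationBound` ↦ **`exists_single_place_bound_below_stewartYu`**
  (`ν_p(abc) · log p ≤ C · rad(abc)^{1/3−δ}` at the primes `p ≤ rad(abc)^{1/3−2δ}`), and the auxiliary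
  `log_max_two_mul_log_le_mul_rpow (hB : BakerShapeBound (1/3) 3)` ↦ **`log_max_two_mul_log_le_mul_rpow_holds`**
  (`log max{e, 2 log c} ≤ C(η) · rad(abc)^η`; its input is Stewart–Yu 2001 Thm 1, a theorem of the tree via
  `bakerShapeBound_third_three_of_approximationBound`);
* `PlacewiseSzpiroSingleTowerSzpiroFreySmallPrimes.lean` (★ p585848):
  `exists_frey_tower_le_mul_rpow` ↦ **`exists_frey_tower_le_mul_rpow_holds`**
  (`ord_v(Δ_min(W)) · log p_v ≤ C(η) · p_v · N_W^η` at every odd place of the Frey curve `W` of an abc triple),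
  `exists_frey_tower_le_of_natGenerator_le` ↦ **`exists_frey_tower_le_of_natGenerator_le_holds`**
  (the first deliverable on the Frey locus at the small odd places: `≤ C · N_W^{1/3−δ}` for `p_v ≤ N_W^{1/3−2δ}`);
* `PlacewiseSzpiroSingleTowerSzpiroFreyLargePrimes.lean` (★ p586559):
  `epsShapeBound_of_odd_largePrime_bound` ↦ **`epsShapeBound_of_odd_largePrime_bound_holds`**
  (a tower bound `≤ C · R^{1/3−δ}` at the LARGE odd primes alone gives `EpsShapeBound (1/3 − δ)`),
  `frey_odd_firstDeliverable_iff_exists_epsShapeBound_lt_third` ↦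
  **`frey_odd_firstDeliverable_iff_exists_epsShapeBound_lt_third_holds`**
  (on the Frey locus, the odd-place first deliverable ⟺ `∃ θ < 1/3, EpsShapeBound θ`, i.e. beating Stewart–Yu 2001).

HONESTY (D-0154 (2)). This converts the three ★ files from PROVED-MOD-FACT (`PastenApproximationBound K`) to PROVED
AS TYPED — nothing more: the statements are the tree's typed shapes (existential constants; the constants inside the rung
are the cell's, not print's); no new bound for `log c`; the crux `SingleTowerSzpiro`, A1′ and A-PS are NOT abc and are
not proved here; abc moved by 0; typed ≠ proved. No summit credit.

References: [StewartYu2001] Duke Math. J. 108 (2001), Thm 1 and its proof; [Pasten2024] Invent. Math. 236 (2024),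
Thm 2.1; [EvertseGyory2015] Thm 4.2.1 (p. 68).
-/

noncomputable section

open Finset Real IsDedekindDomain
open Literature.NumberTheory.DiophantineGeometry
open Literature.NumberTheory.DiophantineGeometry.Dioph
open Literature.NumberTheory.EllipticCurves
open Literature.Barriers.ABC

-- `Summit.<Summit>.<Problem>` is the mandated summit-side namespace (CONVENTIONS §2); for the
-- single-conjunct summit `ABC` the two coincide, so the duplicate `ABC.ABC` is deliberate.
set_option linter.dupNamespace false

namespace Summit.ABC.ABC.Theorems.SingleTowerSzpiroLine

/-! ### `PlacewiseSzpiroSingleTowerSzpiroBakerSinglePlace.lean`, unconditionally -/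

/-- **The single-place bound of the Baker method, unconditionally.** For every `η > 0` there is `C > 0` such that
for every abc triple `a + b = c` and every prime `p ∣ abc`,

  `ν_p(abc) · log p ≤ C · p · rad(abc)^η`

(`exists_single_place_bound_of_approximationBound` at the rung `approximationBound_rat_holds`, ✓ p584875:
`∃ K ≥ 1, PastenApproximationBound K`, Matveev + Yu over `ℚ`, proved in the tree).
[cite: StewartYu2001, Theorem 1 (proof: the p-adic orders at the primes of a, b, c)] -/
theorem exists_single_place_bound {η : ℝ} (hη : 0 < η) :
    ∃ C : ℝ, 0 < C ∧ ∀ a b c : ℕ, IsABCTriple a b c → ∀ p : ℕ, p.Prime → p ∣ a * b * c →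
      ((a * b * c).factorization p : ℝ) * Real.log p ≤ C * p * (rad a b c : ℝ) ^ η := by
  obtain ⟨K, hK, hP⟩ := approximationBound_rat_holds
  exact exists_single_place_bound_of_approximationBound hK hP hη

/-- **Below Stewart–Yu at the small primes, unconditionally.** For every `δ > 0` there is `C > 0` such that for
every abc triple and every prime `p ∣ abc` with `p ≤ rad(abc)^{1/3 − 2δ}`:

  `ν_p(abc) · log p ≤ C · rad(abc)^{1/3 − δ}`

(`exists_single_place_bound_below_stewartYu_of_approximationBound` at the rung `approximationBound_rat_holds`).
[cite: StewartYu2001, Theorem 1 (proof: the p-adic orders at the primes of a, b, c)] -/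
theorem exists_single_place_bound_below_stewartYu {δ : ℝ} (hδ : 0 < δ) :
    ∃ C : ℝ, 0 < C ∧ ∀ a b c : ℕ, IsABCTriple a b c → ∀ p : ℕ, p.Prime → p ∣ a * b * c →
      (p : ℝ) ≤ (rad a b c : ℝ) ^ ((1 : ℝ) / 3 - 2 * δ) →
      ((a * b * c).factorization p : ℝ) * Real.log p ≤ C * (rad a b c : ℝ) ^ ((1 : ℝ) / 3 - δ) := by
  obtain ⟨K, hK, hP⟩ := approximationBound_rat_holds
  exact exists_single_place_bound_below_stewartYu_of_approximationBound hK hP hδ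

/-- **`Y = log max{e, 2 log c}` is sub-polynomial in the radical, unconditionally**: for `η > 0` there is
`C ≥ 1` with `log (max (exp 1) (2 log c)) ≤ C · rad(abc)^η` for every abc triple — the auxiliary
`log_max_two_mul_log_le_mul_rpow`, whose input `BakerShapeBound (1/3) 3` (Stewart–Yu 2001 Thm 1) is supplied by
`bakerShapeBound_third_three_of_approximationBound` at the rung `approximationBound_rat_holds`.
[cite: StewartYu2001, Theorem 1] -/
theorem log_max_two_mul_log_le_mul_rpow_holds {η : ℝ} (hη : 0 < η) :
    ∃ C : ℝ, 1 ≤ C ∧ ∀ a b c : ℕ, IsABCTriple a b c →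
      Real.log (max (Real.exp 1) (2 * Real.log c)) ≤ C * (rad a b c : ℝ) ^ η := by
  obtain ⟨K, hK, hP⟩ := approximationBound_rat_holds
  exact log_max_two_mul_log_le_mul_rpow (bakerShapeBound_third_three_of_approximationBound hK hP) hη

/-! ### `PlacewiseSzpiroSingleTowerSzpiroFreySmallPrimes.lean`, unconditionally -/

/-- **`η`-form on the Frey locus, unconditionally: the Frey tower at an odd place is `≤ C(η) · p_v · N_W^η`.**
For every `η > 0` there is `C > 0` with `ord_v(Δ_min(W)) · log p_v ≤ C · p_v · N_W^η` for every abc triple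
(`W : y² = x(x − a)(x + b)` its Frey–Hellegouarch curve) and every place `v ∤ 2`
(`exists_frey_tower_le_mul_rpow` at the rung `approximationBound_rat_holds`). [folklore] -/
theorem exists_frey_tower_le_mul_rpow_holds {η : ℝ} (hη : 0 < η) :
    ∃ C : ℝ, 0 < C ∧ ∀ a b c : ℕ, IsABCTriple a b c → ∀ v : HeightOneSpectrum ℤ,
      Rat.HeightOneSpectrum.natGenerator v ≠ 2 →
      ((freyCurve (a : ℤ) (b : ℤ)).ordMinimalDiscriminant v : ℝ) *
          Real.log (Rat.HeightOneSpectrum.natGenerator v : ℝ) ≤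
        C * (Rat.HeightOneSpectrum.natGenerator v : ℝ) *
          (((freyCurve (a : ℤ) (b : ℤ)).conductorNorm ℤ : ℕ) : ℝ) ^ η := by
  obtain ⟨K, hK, hP⟩ := approximationBound_rat_holds
  exact exists_frey_tower_le_mul_rpow hK hP hη

/-- **The first deliverable on the Frey locus at the small odd places, unconditionally.** For every `δ > 0`
there is `C > 0` such that for every abc triple `a + b = c`, its Frey–Hellegouarch curve `W`, and every place
`v ∤ 2` with `p_v ≤ N_W^{1/3 − 2δ}`:

  `ord_v(Δ_min(W)) · log p_v ≤ C · N_W^{1/3 − δ}`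

(`exists_frey_tower_le_of_natGenerator_le` at the rung `approximationBound_rat_holds`). The registered stub
`stub_firstDeliverable_towerBelowStewartYu` asks this at EVERY place of EVERY `E/ℚ`; this is the Frey locus at the
small odd places only. [folklore] -/
theorem exists_frey_tower_le_of_natGenerator_le_holds {δ : ℝ} (hδ : 0 < δ) :
    ∃ C : ℝ, 0 < C ∧ ∀ a b c : ℕ, IsABCTriple a b c → ∀ v : HeightOneSpectrum ℤ,
      Rat.HeightOneSpectrum.natGenerator v ≠ 2 →
      (Rat.HeightOneSpectrum.natGenerator v : ℝ) ≤
        (((freyCurve (a : ℤ) (b : ℤ)).conductorNorm ℤ : ℕ) : ℝ) ^ ((1 : ℝ) / 3 - 2 * δ) →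
      ((freyCurve (a : ℤ) (b : ℤ)).ordMinimalDiscriminant v : ℝ) *
          Real.log (Rat.HeightOneSpectrum.natGenerator v : ℝ) ≤
        C * (((freyCurve (a : ℤ) (b : ℤ)).conductorNorm ℤ : ℕ) : ℝ) ^ ((1 : ℝ) / 3 - δ) := by
  obtain ⟨K, hK, hP⟩ := approximationBound_rat_holds
  exact exists_frey_tower_le_of_natGenerator_le hK hP hδ

/-! ### `PlacewiseSzpiroSingleTowerSzpiroFreyLargePrimes.lean`, unconditionally -/

/-- **Beating Stewart–Yu from the large odd primes alone, unconditionally.** Let `0 < δ ≤ 1/6`. If there is `C`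
with `ν_p(abc) · log p ≤ C · R^{1/3−δ}` for every abc triple and every ODD prime `p ∣ abc` with `p > R^{1/3−2δ}`
(`R = rad(abc)`), then `EpsShapeBound (1/3 − δ)` (for every `ε > 0`, `log c ≤ κ R^{1/3−δ+ε}` for all abc triples)
— the small primes and `p = 2` are paid by `exists_single_place_bound`
(`epsShapeBound_of_odd_largePrime_bound` at the rung `approximationBound_rat_holds`). [folklore] -/
theorem epsShapeBound_of_odd_largePrime_bound_holds {δ : ℝ} (hδ : 0 < δ) (hδ6 : δ ≤ 1 / 6) {C : ℝ}
    (hlarge : ∀ a b c : ℕ, IsABCTriple a b c → ∀ p : ℕ, p.Prime → p ∣ a * b * c → p ≠ 2 →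
      (rad a b c : ℝ) ^ ((1 : ℝ) / 3 - 2 * δ) < p →
      ((a * b * c).factorization p : ℝ) * Real.log p ≤ C * (rad a b c : ℝ) ^ ((1 : ℝ) / 3 - δ)) :
    EpsShapeBound (1 / 3 - δ) := by
  obtain ⟨K, hK, hP⟩ := approximationBound_rat_holds
  exact epsShapeBound_of_odd_largePrime_bound hK hP hδ hδ6 hlarge

/-- **On the Frey locus, the odd-place first deliverable ⟺ beating Stewart–Yu, unconditionally**:
`(∃ δ > 0, ∃ C, ∀ abc triples, ∀ v ∤ 2, ord_v(Δ_min(W)) · log p_v ≤ C · N_W^{1/3−δ}) ↔ ∃ θ < 1/3, EpsShapeBound θ`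
(`frey_odd_firstDeliverable_iff_exists_epsShapeBound_lt_third` at the rung `approximationBound_rat_holds`).
The right-hand side negates the state of the art catalogued as `Literature.Barriers.ABC.BakerMethodBounds`
(`θ = 1/3`, Stewart–Yu 2001); neither side is asserted here. [folklore] -/
theorem frey_odd_firstDeliverable_iff_exists_epsShapeBound_lt_third_holds :
    (∃ δ : ℝ, 0 < δ ∧ ∃ C : ℝ, ∀ a b c : ℕ, IsABCTriple a b c → ∀ v : HeightOneSpectrum ℤ,
      Rat.HeightOneSpectrum.natGenerator v ≠ 2 →
      ((freyCurve (a : ℤ) (b : ℤ)).ordMinimalDiscriminant v : ℝ) *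
          Real.log (Rat.HeightOneSpectrum.natGenerator v : ℝ) ≤
        C * (((freyCurve (a : ℤ) (b : ℤ)).conductorNorm ℤ : ℕ) : ℝ) ^ ((1 : ℝ) / 3 - δ)) ↔
    ∃ θ : ℝ, θ < 1 / 3 ∧ EpsShapeBound θ := by
  obtain ⟨K, hK, hP⟩ := approximationBound_rat_holds
  exact frey_odd_firstDeliverable_iff_exists_epsShapeBound_lt_third hK hP

end Summit.ABC.ABC.Theorems.SingleTowerSzpiroLine

end
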